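import Summits.ABC.IUTFork.Cor312EdgeAggregate
import HarnessLib

/-!
# [IUTchIII] Corollary 3.12 — readings of the edge, V ter: the aggregate Reading 4 IN THE AUTHOR'S NOUNS versus `Cor312At`
# under intermediate values at ONE component (proof-only companion of `Cor312EdgeAggregate.lean`, RQ7 pass by abc-iut-w5-d204)

Record-only file (D-0012) of the abc-iut cell; TAKES NO SIDE. V-e `Cor312EdgeAggregate.lean` (abc-iut-c312-2) types
Yamashita's Reading 4 with the print's GLOBAL quantifier over c312-1's `Thm311.PilotNouns` —
`PilotNouns.QCongruentSubHullAgg P n m` — and proves it SUFFICIENT for the author's aggregate inequality `Cor312At`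
(`cor312At_of_qCongruentSubHullAgg`); its header records in prose ("HOW LITTLE IS LEFT at the aggregate level") that the
converse holds as soon as the hulls admit admissible sub-regions of every intermediate aggregate log-volume. abc-iut-w5-d018's
sibling `Cor312EdgeAggregateIVT.lean` gives the kernel form of that sentence for V-e's ABSTRACT finite family
`C : ι → Cor312Setting`. This file gives it for the author's nouns themselves (labels `j ∈ 𝔽_l^⋇`, places `v_ℚ ∈ 𝕍_ℚ`,
`∑ᶠ`-sums with the `1/l⋇` procession normalisation of [IUTchIII] Cor. 3.12 p. 173 — paraphrase: the procession-normalized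
mono-analytic log-volume, the average being taken over `j ∈ 𝔽_l^⋇`):

* the hypothesis `hivt` (stated inline, no new `def`) — at ONE component `(j₀, v_{ℚ,0})` every real `y ≤ μ^log(U^{hol}_{j₀,v_{ℚ,0}})` is the
  log-volume of an admissible sub-region of `U^{hol}_{j₀,v_{ℚ,0}}` (intermediate values down to `−∞`; what an archimedean packet
  supplies — balls of every radius);
* `qCongruentSubHullAgg_of_cor312At_of_hullIVTAt` — under it, the aggregate INEQUALITY `Cor312At` already yields the aggregate
  Reading 4 `QCongruentSubHullAgg`: `R_{j,v_ℚ} := U^{hol}_{j,v_ℚ}` off `(j₀, v_{ℚ,0})`, the whole (procession-normalized) deficit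
  `l⋇·(−|log(Θ)| − (−|log(q)|))` absorbed at `(j₀, v_{ℚ,0})`;
* `qCongruentSubHullAgg_iff_of_hullIVTAt` — hence, given componentwise admissibility and the two finiteness guards, the
  aggregate Reading 4 and `Cor312At` are EQUIVALENT there: with the print's global quantifier Reading 4 carries no content
  beyond the inequality once one component has intermediate values (V-e's sentence, kernel-checked in the author's nouns).

Bookkeeping over LANDED decls only (c312-1 `PilotNouns`, `Cor312At`, `NegLogThetaReal`, `NegLogQReal`; V-e
`QCongruentSubHullAgg`, `cor312At_of_qCongruentSubHullAgg`); nothing here asserts that any reading is supplied or excluded by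
[IUTchIII]; typed ≠ proved; no side is taken on Cor. 3.12.
[cite: Yamashita2024IUTSurvey, Cor. 13.13 proof p. 360 ll. 30–40] [claim: Mochizuki2012, status: disputed]
-/

noncomputable section

namespace Summit.ABC.IUTFork

open Set

namespace Thm311.PilotNouns

variable {T : ThetaIndex} {S : LatticeSituation T} (P : PilotNouns S)

/-- The nested procession sum `Σᶠ_j Σᶠ_{v_ℚ} f (j, v_ℚ)` is the sum over the pairs `(j, v_ℚ)` when `f` has finite support
(`finsum_curry`, read backwards). [folklore] -/
private theorem finsum_pair_eq {f : T.LabelStar × T.VQ → ℝ} (hf : (Function.support f).Finite) :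
    ∑ᶠ (j : T.LabelStar) (vQ : T.VQ), f (j, vQ) = ∑ᶠ p : T.LabelStar × T.VQ, f p :=
  (finsum_curry f hf).symm

/-- **V-e's "HOW LITTLE IS LEFT", kernel form in the author's nouns.** If at ONE component `(j₀, v_{ℚ,0})` the hull has
intermediate values down to `−∞` (hypothesis `hivt`), then the author's aggregate inequality `Cor312At` (with its two finiteness
guards `NegLogThetaReal`, `NegLogQReal`) already yields the aggregate Reading 4 `QCongruentSubHullAgg`: take
`R_{j,v_ℚ} := U^{hol}_{j,v_ℚ}` at every other component and absorb the whole deficit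
`Σ μ^log(U^{hol}) − Σ μ^log(q-region) ≥ 0` at `(j₀, v_{ℚ,0})`. [folklore] -/
theorem qCongruentSubHullAgg_of_cor312At_of_hullIVTAt (n m : ℤ) (j₀ : T.LabelStar) (vQ₀ : T.VQ)
    (hivt : ∀ y : ℝ, y ≤ (S.D n).logvol j₀.1 vQ₀ (P.Uhol n m j₀ vQ₀) →
      ∃ R : Set (S.L.Packet j₀.1 vQ₀),
        (S.D n).Adm j₀.1 vQ₀ R ∧ R ⊆ P.Uhol n m j₀ vQ₀ ∧ (S.D n).logvol j₀.1 vQ₀ R = y)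
    (h : P.Cor312At n m) : P.QCongruentSubHullAgg n m := by
  classical
  obtain ⟨hreal, hqreal, hle⟩ := h
  -- the two summands as functions of the pair `(j, v_ℚ)`
  set θ : T.LabelStar × T.VQ → ℝ := fun p => (S.D n).logvol p.1.1 p.2 (P.Uhol n m p.1 p.2) with hθ
  set q : T.LabelStar × T.VQ → ℝ := fun p => (S.D n).logvol p.1.1 p.2 (P.qRegion n m p.1 p.2) with hq
  have hθfin : (Function.support θ).Finite := hreal.2
  have hqfin : (Function.support q).Finite := hqreal.2
  have hl : (0 : ℝ) < (T.lstar : ℝ) := by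
    have := T.two_le_lstar
    exact_mod_cast (lt_of_lt_of_le (by norm_num : (0 : ℕ) < 2) this)
  -- the un-normalized inequality `Σ q ≤ Σ θ`
  have hsumle : ∑ᶠ p, q p ≤ ∑ᶠ p, θ p := by
    have h1 : (1 / (T.lstar : ℝ)) * ∑ᶠ p, q p ≤ (1 / (T.lstar : ℝ)) * ∑ᶠ p, θ p := by
      have := hle
      unfold negLogQ negLogTheta at this
      rwa [finsum_pair_eq hqfin, finsum_pair_eq hθfin] at this
    exact le_of_mul_le_mul_left h1 (by positivity)
  -- the target value at `(j₀, v_{ℚ,0})`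
  set p₀ : T.LabelStar × T.VQ := (j₀, vQ₀) with hp₀
  set y : ℝ := θ p₀ - (∑ᶠ p, θ p - ∑ᶠ p, q p) with hy
  have hyle : y ≤ (S.D n).logvol j₀.1 vQ₀ (P.Uhol n m j₀ vQ₀) := by
    show y ≤ θ p₀
    rw [hy]; linarith
  obtain ⟨R₀, hR₀adm, hR₀sub, hR₀vol⟩ := hivt y hyle
  -- the family: `U^{hol}` everywhere, `R₀` at `p₀`
  let Rp : ∀ p : T.LabelStar × T.VQ, Set (S.L.Packet p.1.1 p.2) :=
    Function.update (fun p => P.Uhol n m p.1 p.2) p₀ R₀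
  have hRp₀ : Rp p₀ = R₀ := Function.update_self ..
  have hRp_ne : ∀ p, p ≠ p₀ → Rp p = P.Uhol n m p.1 p.2 := fun p hp => Function.update_of_ne hp ..
  -- its log-volumes: `θ` off `p₀`, `y` at `p₀`
  have hvolRp : ∀ p, (S.D n).logvol p.1.1 p.2 (Rp p) = Function.update θ p₀ y p := by
    intro p
    by_cases hp : p = p₀
    · subst hp
      rw [Function.update_self, hRp₀]
      exact hR₀vol
    · rw [Function.update_of_ne hp, hRp_ne p hp]
  have hupd : Function.update θ p₀ y = fun p => θ p + (Pi.single p₀ (y - θ p₀) : T.LabelStar × T.VQ → ℝ) p := by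
    funext p
    by_cases hp : p = p₀
    · subst hp; simp
    · simp [Function.update_of_ne hp, Pi.single_eq_of_ne hp]
  have hsingle_fin : (Function.support (Pi.single p₀ (y - θ p₀) : T.LabelStar × T.VQ → ℝ)).Finite :=
    (Set.finite_singleton p₀).subset fun p hp => by
      by_contra hne
      exact hp (Pi.single_eq_of_ne hne _)
  have hupd_fin : (Function.support (Function.update θ p₀ y)).Finite := by
    rw [hupd]
    exact (hθfin.union hsingle_fin).subset (Function.support_add _ _)
  -- admissibility and containment of the family, pair by pair
  have hadmRp : ∀ p, (S.D n).Adm p.1.1 p.2 (Rp p) := by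
    intro p
    by_cases hp : p = p₀
    · rw [hp, hRp₀]; exact hR₀adm
    · rw [hRp_ne p hp]; exact hreal.1 p.1 p.2
  have hsubRp : ∀ p, Rp p ⊆ P.Uhol n m p.1 p.2 := by
    intro p
    by_cases hp : p = p₀
    · rw [hp, hRp₀]; exact hR₀sub
    · rw [hRp_ne p hp]
  refine ⟨fun j vQ => Rp (j, vQ), fun j vQ => hadmRp (j, vQ), fun j vQ => hsubRp (j, vQ), ?_, ?_⟩
  · -- finite support of the log-volumes
    refine hupd_fin.subset ?_
    rintro ⟨j, vQ⟩ hp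
    have hv := hvolRp (j, vQ)
    simp only [Set.mem_setOf_eq] at hp
    rw [Function.mem_support, ← hv]
    exact hp
  · -- the aggregate identity
    have hcurry : ∑ᶠ (j : T.LabelStar) (vQ : T.VQ), (S.D n).logvol j.1 vQ (Rp (j, vQ)) =
        ∑ᶠ p : T.LabelStar × T.VQ, Function.update θ p₀ y p := by
      rw [← finsum_pair_eq hupd_fin]
      exact finsum_congr fun j => finsum_congr fun vQ => hvolRp (j, vQ)
    rw [hcurry, hupd, finsum_add_distrib hθfin hsingle_fin,
      finsum_eq_single (Pi.single p₀ (y - θ p₀) : T.LabelStar × T.VQ → ℝ) p₀ fun p hp => Pi.single_eq_of_ne hp _,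
      Pi.single_eq_same]
    unfold negLogQ
    rw [finsum_pair_eq hqfin]
    congr 1
    rw [hy]; ring

/-- Hence, with intermediate values at one component and componentwise admissibility (`ComponentAdm`, needed for the
forward direction V-e `cor312At_of_qCongruentSubHullAgg`), the aggregate Reading 4 in the author's nouns and the author's
aggregate inequality are EQUIVALENT modulo the two finiteness guards: `Cor312At ↔ (−|log Θ| ∈ ℝ) ∧ (−|log q| ∈ ℝ) ∧
QCongruentSubHullAgg`. [folklore] -/
theorem cor312At_iff_qCongruentSubHullAgg_of_hullIVTAt (n m : ℤ) (j₀ : T.LabelStar) (vQ₀ : T.VQ)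
    (hadm : ∀ (j : T.LabelStar) (vQ : T.VQ), P.ComponentAdm n m j vQ)
    (hivt : ∀ y : ℝ, y ≤ (S.D n).logvol j₀.1 vQ₀ (P.Uhol n m j₀ vQ₀) →
      ∃ R : Set (S.L.Packet j₀.1 vQ₀),
        (S.D n).Adm j₀.1 vQ₀ R ∧ R ⊆ P.Uhol n m j₀ vQ₀ ∧ (S.D n).logvol j₀.1 vQ₀ R = y) :
    P.Cor312At n m ↔ P.NegLogThetaReal n m ∧ P.NegLogQReal n m ∧ P.QCongruentSubHullAgg n m :=
  ⟨fun h => ⟨h.1, h.2.1, P.qCongruentSubHullAgg_of_cor312At_of_hullIVTAt n m j₀ vQ₀ hivt h⟩,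
    fun h => P.cor312At_of_qCongruentSubHullAgg n m hadm h.1 h.2.1 h.2.2⟩

end Thm311.PilotNouns

end Summit.ABC.IUTFork

end
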